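import Literature.NumberTheory.EllipticCurves.StrictSelmerRankOne
import HarnessLib

/-!
# (P4) — algebraic lemmas for `Additive.StrictSelmerDominatesShaAt`: the `ℤ_p`-structure of `E(ℚ_p)`,
# integer approximation in `ℤ_p`, the Bezout split of a torsion point, and `Γ_E`-fixedness of
# `E`-rational points in `E(Ē)` (cell `b2b-bsdres`, team n1011, seat p01 GEN 2; lead GEN 6 R5-37 deal;
# x1b GEN 26's P4-PLAN §3 (S2)/(S4)/(S5), rephrased so that (S1) is not needed; the cohomological core
# and the discharge are the sequel `StrictSelmerDominatesSha.lean`)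

HONEST FRAMING (cell `b2b-bsdres`, run/shared/lean/b2b/bsd-rank1-residual/, verbatim in every
file): prove what is provable now; shrink each hard class to its core with data; no claim beyond
stated classes. Research routes; nothing is booked; no label changes. Elementary algebra only;
THEOREMS ONLY — NO definition, NO Literature fact; each lemma is useful alone (x1b §3).

* §1 `exists_addMonoidHom_padicInt_ker_torsion_pow_mem_range`: `E(ℚ_p)` carries `λ : E(ℚ_p) → ℤ_p`
  with kernel EXACTLY the torsion AND `p^b ℤ_p ⊆ im λ` for some `b` (AEC VII.6.3: a finite-index
  subgroup `A ≅ ℤ_p`, `λ = e ∘ (m·)`, `m = [E(ℚ_p):A] = p^b m₁`, `p ∤ m₁` a unit of `ℤ_p`).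
* §2 `exists_int_pow_mul_sub_mul_eq`: for `u ≠ 0`, `x ∈ ℤ_p`, `k, b`: INTEGER `a` and `w ∈ ℤ_p` with
  `p^{v_p(u)}·x − a·u = p^{k+v_p(u)}·(p^b·w)` (`PadicInt.unitCoeff_spec`, `PadicInt.appr`).
* §3 `exists_eq_add_nsmul_of_isOfFinAddOrder`: a torsion point is `T₁ + p^n • T₂`, `p^b • T₁ = 0`.
* §4 `smul_eq_of_map_eq`: `E`-rational points are `Γ_E`-fixed in `localPoints W E`.

References: [SilvermanAEC2009] Prop. VII.6.3, VIII.§1; [GreenbergLNM1716] §2 (pp. 62–63).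
-/

noncomputable section

open scoped Classical

open WeierstrassCurve Literature.NumberTheory.EllipticCurves Literature.NumberTheory.GaloisRepresentations

universe u

namespace Summit.BirchSwinnertonDyer.Rank1Residual.Additive.StrictSha

/-! ### §1 `λ : E(ℚ_p) → ℤ_p` with torsion kernel and `p^b ℤ_p` in the image -/

/-- **`λ : E(ℚ_p) → ℤ_p` vanishing exactly on torsion, with `p^b·ℤ_p ⊆ im λ`.** From AEC VII.6.3
(`exists_finiteIndex_addEquiv_padicInt_holds`: `A ≤ E(ℚ_p)` of finite index `m` with `e : A ≃ ℤ_p`):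
`λ := e ∘ (m·)`; its kernel is the torsion (as in `exists_addMonoidHom_padicInt_apply_eq_zero_iff`),
and writing `m = p^b·m₁` with `p ∤ m₁`, for every `z` the point `Y := e⁻¹(m₁⁻¹ z) ∈ A` has
`λ Y = m·m₁⁻¹·z = p^b z`. [cite: SilvermanAEC2009, Prop. VII.6.3] -/
theorem exists_addMonoidHom_padicInt_ker_torsion_pow_mem_range (p : ℕ) [Fact p.Prime]
    (V : WeierstrassCurve ℚ_[p]) [V.IsElliptic] :
    ∃ (lam : V.toAffine.Point →+ ℤ_[p]) (b : ℕ), (∀ X, lam X = 0 ↔ IsOfFinAddOrder X) ∧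
      ∀ z : ℤ_[p], ∃ Y, lam Y = (p : ℤ_[p]) ^ b * z := by
  have hp : p.Prime := Fact.out
  obtain ⟨A, hA, ⟨e⟩⟩ := Literature.NumberTheory.EllipticCurves.exists_finiteIndex_addEquiv_padicInt_holds p V
  haveI := hA
  have hidx : A.index ≠ 0 := AddSubgroup.FiniteIndex.index_ne_zero
  set m := A.index with hm
  let mulIdx : V.toAffine.Point →+ A :=
    AddMonoidHom.mk' (fun X => ⟨m • X, A.nsmul_index_mem X⟩) fun X Y =>
      Subtype.ext (smul_add m X Y)
  -- `m = p^b · m₁`, `p ∤ m₁`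
  set b := padicValNat p m with hb
  obtain ⟨m₁, hm₁⟩ : p ^ b ∣ m := pow_padicValNat_dvd
  have hm₁p : ¬ p ∣ m₁ := by
    intro h
    have h1 : p ^ (b + 1) ∣ m := by rw [hm₁, pow_succ]; exact mul_dvd_mul_left _ h
    exact pow_succ_padicValNat_not_dvd hidx h1
  have hu : IsUnit (m₁ : ℤ_[p]) := by
    rw [PadicInt.isUnit_iff, PadicInt.norm_natCast_eq_one_iff]
    exact (Nat.Prime.coprime_iff_not_dvd hp).mpr hm₁p
  refine ⟨e.toAddMonoidHom.comp mulIdx, b, fun X => ?_, fun z => ?_⟩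
  · constructor
    · intro h
      have h1 : mulIdx X = 0 := by
        have : e (mulIdx X) = 0 := h
        exact e.injective (this.trans (map_zero e).symm)
      have h2 : m • X = 0 := congrArg Subtype.val h1
      exact isOfFinAddOrder_iff_nsmul_eq_zero.mpr ⟨m, Nat.pos_of_ne_zero hidx, h2⟩
    · intro h
      obtain ⟨n, hn, hnX⟩ := isOfFinAddOrder_iff_nsmul_eq_zero.mp h
      have h3 : n • (e.toAddMonoidHom.comp mulIdx) X = 0 := by
        rw [← map_nsmul, hnX, map_zero]
      exact (smul_eq_zero.mp h3).resolve_left hn.ne'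
  · refine ⟨((e.symm (hu.unit⁻¹ * z) : A) : V.toAffine.Point), ?_⟩
    have hmul : mulIdx ((e.symm (hu.unit⁻¹ * z) : A) : V.toAffine.Point) =
        m • e.symm (hu.unit⁻¹ * z) := by
      apply Subtype.ext
      simp [mulIdx]
    change e (mulIdx _) = _
    rw [hmul, map_nsmul, e.apply_symm_apply, nsmul_eq_mul, hm₁, Nat.cast_mul, Nat.cast_pow,
      mul_assoc, ← mul_assoc (m₁ : ℤ_[p]), IsUnit.mul_val_inv, one_mul]

/-! ### §2 Integer approximation in `ℤ_p` -/

/-- **Integer approximation.** For `u ≠ 0`, `x ∈ ℤ_p` and `k b : ℕ`, with `n := k + v_p(u)` there are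
an INTEGER `a` and `w ∈ ℤ_p` with `p^{v_p(u)}·x − a·u = p^n·(p^b·w)`: write `u = u₀·p^{v}` (`u₀` a unit,
`PadicInt.unitCoeff_spec`) and take `a ≡ x·u₀⁻¹ (mod p^{k+b})` (`PadicInt.appr`). [folklore] -/
theorem exists_int_pow_mul_sub_mul_eq (p : ℕ) [Fact p.Prime] {u : ℤ_[p]} (hu : u ≠ 0) (x : ℤ_[p])
    (k b : ℕ) :
    ∃ (a : ℤ) (w : ℤ_[p]),
      (p : ℤ_[p]) ^ u.valuation * x - (a : ℤ_[p]) * u =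
        (p : ℤ_[p]) ^ (k + u.valuation) * ((p : ℤ_[p]) ^ b * w) := by
  set v := u.valuation with hv
  set u₀ := PadicInt.unitCoeff hu with hu₀
  have hspec : u = (u₀ : ℤ_[p]) * (p : ℤ_[p]) ^ v := by
    have h := PadicInt.unitCoeff_spec hu
    rwa [← hv] at h
  set c : ℤ_[p] := x * ((u₀⁻¹ : ℤ_[p]ˣ) : ℤ_[p]) with hc
  obtain ⟨t, ht⟩ := Ideal.mem_span_singleton'.mp (PadicInt.appr_spec (k + b) c)
  -- `t * p^(k+b) = c - appr c (k+b)`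
  refine ⟨(PadicInt.appr c (k + b) : ℤ), t * (u₀ : ℤ_[p]), ?_⟩
  have happr : ((PadicInt.appr c (k + b) : ℕ) : ℤ_[p]) = c - t * (p : ℤ_[p]) ^ (k + b) := by
    linear_combination ht
  have hinv : ((u₀⁻¹ : ℤ_[p]ˣ) : ℤ_[p]) * (u₀ : ℤ_[p]) = 1 := Units.inv_mul u₀
  rw [Int.cast_natCast, happr, hc, hspec, pow_add, pow_add]
  linear_combination (-(x * (p : ℤ_[p]) ^ v)) * hinv

/-! ### §3 Bezout split of a torsion point -/

/-- **Bezout split.** In an additive commutative group, a point `T` of finite order `N = p^b·N₁`,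
`p ∤ N₁`, is `T₁ + p^n • T₂` with `p^b • T₁ = 0` (`α N₁ + β p^n = 1`: `T₁ := α N₁ • T`,
`T₂ := β • T`). [folklore] -/
theorem exists_eq_add_nsmul_of_isOfFinAddOrder (p : ℕ) [Fact p.Prime] {G : Type*} [AddCommGroup G]
    {T : G} (hT : IsOfFinAddOrder T) (n : ℕ) :
    ∃ (T₁ T₂ : G) (b : ℕ), p ^ b • T₁ = 0 ∧ T = T₁ + p ^ n • T₂ := by
  have hp : p.Prime := Fact.out
  obtain ⟨N, hN, hNT⟩ := isOfFinAddOrder_iff_nsmul_eq_zero.mp hT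
  set b := padicValNat p N with hb
  obtain ⟨N₁, hN₁⟩ : p ^ b ∣ N := pow_padicValNat_dvd
  have hN₁p : ¬ p ∣ N₁ := by
    intro h
    have h1 : p ^ (b + 1) ∣ N := by rw [hN₁, pow_succ]; exact mul_dvd_mul_left _ h
    exact pow_succ_padicValNat_not_dvd hN.ne' h1
  have hcop : Nat.Coprime N₁ (p ^ n) :=
    (Nat.Coprime.pow_right n ((Nat.Prime.coprime_iff_not_dvd hp).mpr hN₁p).symm)
  obtain ⟨α, β, hαβ⟩ : ∃ α β : ℤ, α * N₁ + β * (p : ℤ) ^ n = 1 := by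
    obtain ⟨α, β, h⟩ := hcop.isCoprime
    exact ⟨α, β, by push_cast at h; linarith⟩
  refine ⟨(α * N₁) • T, β • T, b, ?_, ?_⟩
  · have hmul : ((p ^ b : ℕ) : ℤ) * (α * N₁) = α * (N : ℤ) := by rw [hN₁]; push_cast; ring
    rw [← natCast_zsmul, smul_smul, hmul, ← smul_smul, natCast_zsmul, hNT, smul_zero]
  · have h1 : T = (α * N₁ + β * (p : ℤ) ^ n) • T := by rw [hαβ, one_zsmul]
    conv_lhs => rw [h1]
    rw [add_zsmul]
    congr 1
    rw [mul_comm, ← smul_smul, ← Nat.cast_pow, natCast_zsmul]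


/-! ### §4 `E`-rational points are `Γ_E`-fixed in `E(Ē)` -/

/-- `E`-rational points are fixed by `Γ_E` inside `E(Ē)` (`localPoints`): the action is through
`K`-automorphisms of `Ē` that are `E`-linear. Silverman, AEC, VIII.§1. [folklore] -/
theorem smul_eq_of_map_eq {K : Type u} [Field K] (W : WeierstrassCurve K) (E : Type u) [Field E]
    [Algebra K E] (τ : Field.absoluteGaloisGroup E) (Y : (W.baseChange E).toAffine.Point)
    {X : localPoints W E}
    (hX : Affine.Point.map (W' := W) (IsScalarTower.toAlgHom K E (AlgebraicClosure E)) Y = X) :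
    τ • X = X := by
  rw [← hX, localPoints.smul_def]
  change Affine.Point.map _ (Affine.Point.map (W' := W) _ Y) = _
  rw [Affine.Point.map_map]
  exact congrArg (fun f => Affine.Point.map (W' := W) f Y)
    (AlgHom.ext fun y => (show AlgebraicClosure E ≃ₐ[E] AlgebraicClosure E from τ).commutes y)

end Summit.BirchSwinnertonDyer.Rank1Residual.Additive.StrictSha

end
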